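import Summits.AtomisticToContinuum.HydrodynamicLimit.Theses.AntiMazurCoboundaries
import Summits.AtomisticToContinuum.HydrodynamicLimit.Theorems.CorrectorPressureDecay.Negative.Frame

/-!
# Negative knowledge for `CorrectorPressureDecay` (stmt-AtomisticToContinuum-14135), II: `g ⊥ 1` is load-bearing

From the standing disprover's `Cruxes/CorrectorPressureDecay/Disproof.lean` §(a.1)
(refuter-cdisprove-stmt-AtomisticToContinuum-14135-0). `CorrectorPressureDecayWithoutOrthogonality` is the crux
`AntiMazurCoboundaries.CorrectorPressureDecay` with the single hypothesis `g ⊥ span(1, v, |v|²)` deleted (all other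
tokens verbatim; it trivially implies the crux), and it is FALSE, unconditionally: with `a = θ = 1`, `u₀ = 0`,
`φ ≡ 1`, `g ≡ κ` (the prover's own amplitude) the observable is the CONSTANT `F ≡ κ(N+1)`; flows exist
(`nonempty_flow`), the global Gibbs law is `Φ_lag`-invariant (`measurePreserving_flow_localGibbsLaw`), so for every
lag and every bounded corrector `W` Jensen gives `∫ e^{2(F − lag⁻¹(W∘Φ_lag − W))} dG_N ≥ e^{2κ(N+1)} > e^{κ(N+1)}`
(`ofReal_exp_le_lintegral_exp_sub_coboundary`) — the defect clause fails at `δ = κ`. Any proof of the crux must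
therefore use the orthogonality of `g` to the constants.
-/

noncomputable section

open MeasureTheory ProbabilityTheory Set Filter Topology
open scoped ENNReal

namespace Summit.AtomisticToContinuum.HydrodynamicLimit.Theorems.CorrectorPressureDecayNegative

open Literature.MathematicalPhysics.KineticTheory (T3 V3 hsDiameter localGibbsLaw)
open Literature.Analysis.FluidPDE (HardSphereFlow Config)

/-- `AntiMazurCoboundaries.CorrectorPressureDecay` with the orthogonality clause
`∀ c₀ c₂ b, ∫ g (c₀ + ⟪b,v⟫ + c₂|v|²) dγ = 0` DELETED (all other tokens verbatim; a variant statement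
refuted below, not a fact). -/
def CorrectorPressureDecayWithoutOrthogonality : Prop :=
  ∀ (a θ : ℝ) (u₀ : V3), 0 < a → 0 < θ → ∃ σ₀ : ℝ, 0 < σ₀ ∧ ∀ σ : ℝ, 0 < σ → σ < σ₀ →
    (∀ (N : ℕ) (Φ : HardSphereFlow (Literature.Analysis.FluidPDE.Torus.geometry (Fin 3)) (hsDiameter σ N) (N + 1)),
      IsProbabilityMeasure (localGibbsLaw σ (fun _ => a) (fun _ => u₀) (fun _ => θ) N Φ)) ∧
    ∃ κ : ℝ, 0 < κ ∧ ∀ (φ : T3 → ℝ) (g : V3 → ℝ), Continuous φ → Continuous g → (∀ x, |φ x| ≤ 1) →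
      (∀ v, |g v| ≤ κ) →
      ∀ δ : ℝ, 0 < δ → ∃ τ₀ : ℝ, 0 < τ₀ ∧ ∃ N₀ : ℕ, ∀ N : ℕ, N₀ ≤ N → ∀ Φ : HardSphereFlow (Literature.Analysis.FluidPDE.Torus.geometry (Fin 3)) (hsDiameter σ N) (N + 1),
        ∃ lag : ℝ, 0 < lag ∧ ∃ W : Config (N + 1) (Fin 3) T3 → ℝ, Measurable W ∧ (∃ C : ℝ, ∀ z, |W z| ≤ C) ∧
          ∫⁻ z, ENNReal.ofReal (Real.exp (2 * ((∑ i, φ (z i).1 * g ((Real.sqrt θ)⁻¹ • ((z i).2 - u₀))) -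
              lag⁻¹ * (W (Φ.flow lag z) - W z))))
            ∂(localGibbsLaw σ (fun _ => a) (fun _ => u₀) (fun _ => θ) N Φ) ≤
            ENNReal.ofReal (Real.exp (δ * (N + 1))) ∧
          ∫⁻ z, ENNReal.ofReal (Real.exp (4 * (τ₀ * ((N + 1 : ℕ) : ℝ) ^ (-(1 / 3 : ℝ)))⁻¹ * |W z|))
            ∂(localGibbsLaw σ (fun _ => a) (fun _ => u₀) (fun _ => θ) N Φ) ≤
            ENNReal.ofReal (Real.exp (δ * (N + 1)))

/-- **Any proof of the crux must use `g ⊥ 1`**: without the orthogonality clause the statement is FALSE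
(witness `a = θ = 1`, `u₀ = 0`, `φ ≡ 1`, `g ≡ κ`, `δ = κ`; `F ≡ κ(N+1)`; Jensen under the flow-invariant `G_N`
for EVERY flow, lag and bounded corrector). [folklore] -/
theorem correctorPressureDecay_false_without_orthogonality : ¬ CorrectorPressureDecayWithoutOrthogonality := by
  intro h
  obtain ⟨σ₀, hσ₀, hσ⟩ := h 1 1 0 one_pos one_pos
  set σ : ℝ := min (σ₀ / 2) 4⁻¹ with hσdef
  have hσpos : 0 < σ := lt_min (by linarith) (by norm_num)
  have hσlt : σ < σ₀ := (min_le_left _ _).trans_lt (by linarith)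
  have hσhalf : σ < 2⁻¹ := (min_le_right _ _).trans_lt (by norm_num)
  obtain ⟨hprob, κ, hκ, hmain⟩ := hσ σ hσpos hσlt
  obtain ⟨τ₀, hτ₀, N₀, hN⟩ := hmain (fun _ => 1) (fun _ => κ) continuous_const continuous_const
    (fun _ => by simp) (fun _ => by simp [abs_of_pos hκ]) κ hκ
  obtain ⟨Φ⟩ := nonempty_flow hσpos hσhalf N₀
  obtain ⟨lag, hlag, W, hWm, ⟨C, hC⟩, h1, _h2⟩ := hN N₀ le_rfl Φ
  haveI := hprob N₀ Φ
  have hT := measurePreserving_flow_localGibbsLaw (σ := σ) 1 1 N₀ Φ lag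
  have hfloor := ofReal_exp_le_lintegral_exp_sub_coboundary hT hWm hC (2 * ((N₀ + 1 : ℝ) * κ)) (2 * lag⁻¹)
  have hrw : ∀ z : Config (N₀ + 1) (Fin 3) T3,
      Real.exp (2 * ((∑ i : Fin (N₀ + 1), (fun _ : T3 => (1 : ℝ)) (z i).1 *
        (fun _ : V3 => κ) ((Real.sqrt 1)⁻¹ • ((z i).2 - 0))) - lag⁻¹ * (W (Φ.flow lag z) - W z))) =
      Real.exp (2 * ((N₀ + 1 : ℝ) * κ) - 2 * lag⁻¹ * (W (Φ.flow lag z) - W z)) := by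
    intro z
    simp only [one_mul, Finset.sum_const, Finset.card_univ, Fintype.card_fin, nsmul_eq_mul,
      Nat.cast_add, Nat.cast_one]
    ring_nf
  simp_rw [hrw] at h1
  have key := hfloor.trans h1
  rw [ENNReal.ofReal_le_ofReal_iff (Real.exp_pos _).le, Real.exp_le_exp] at key
  have : (0 : ℝ) < (N₀ + 1 : ℝ) * κ := by positivity
  nlinarith

end Summit.AtomisticToContinuum.HydrodynamicLimit.Theorems.CorrectorPressureDecayNegative
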